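import Summits.QuantumFields.YangMills.Theorems.ScalingWindowSplitCurvatureAmnesiaStubUniformOfPointwisePrep
import Literature.Analysis.FunctionSpaces.MultilinearBanachSteinhaus
import HarnessLib

/-!
# Uniformity of the lattice Ward functional in the rotation angle (stub `stub_uniformOfPointwise`, part 2 of 2)

Support file for the line `WardDefectSketch` of crux `CurvatureAmnesia` (item stmt-QuantumFields-16192, routes
`ScalingWindowSplit` / `CoincidenceRotationBootstrap`): the registered stub `stub_uniformOfPointwise`, proved verbatim
from the lemmas of `ScalingWindowSplitCurvatureAmnesiaStubUniformOfPointwisePrep.lean`.  Pure proof file: no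
definitions, no notation.

**Statement.**  Let `LS_k(g) := latticeSchwinger r.ρ sch (·.F) k n (fun _ ↦ r.curvature) g` be the renormalised joint
Wilson lattice `n`-point function of the all-curvature string, `L = x₁∂₀ − x₀∂₁` the rotation generator and
`g^θ := g ∘ ρ_θ⁻¹` (`linActTest (planeRot 0 θ) g`).  Assume the lattice TIE (the complexified `LS_k` converge on
off-diagonal real tensors, `n ≠ 0`) and POINTWISE Ward nullity: `Σᵢ LS_k(g₁, …, L gᵢ, …, g_n) → 0` for every real family
`g` with compact, pairwise disjoint supports.  Then for every such family `f` and every `Θ` the Ward functional of the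
rotated families, `W_k(θ; f) := Σᵢ LS_k(f₁^θ, …, (L fᵢ)^θ, …, f_n^θ)`, tends to `0` uniformly in `θ ∈ [-Θ, Θ]`.

**Proof.**
1. `(L g)^θ = L (g^θ)` (`linActTest_rotGen_comm`), so `W_k(θ; f) = Σᵢ LS_k(…, L(fᵢ^θ), …)`; the rotated family `f^θ` is
   again separated, hence `W_k(θ; f) → 0` for every fixed `θ` by the hypothesis.
2. If the convergence were not uniform on `[-Θ, Θ]` there would be `ε > 0`, a subsequence `k_m → ∞` and angles
   `θ_m ∈ [-Θ, Θ]` with `|W_{k_m}(θ_m; f)| ≥ ε`; by compactness `θ_m → θ₀` along a further subsequence.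
3. Local frame at `θ₀` (`stub_uniformOfPointwise_cutoffFrame`): cutoffs `χⱼ` of temperate growth with pairwise disjoint compact supports
   and `χⱼ · fⱼ^θ = fⱼ^θ` for all `θ` near `θ₀`.  The cut-off functionals
   `T_k(g) := Σᵢ LS_k(χ₁g₁, …, L(χᵢgᵢ), …, χ_n g_n)` are continuous multilinear forms on `𝓢(ℝ⁴)ⁿ`
   (`exists_multilinearMap_latticeSchwinger` composed with the continuous linear maps `χⱼ·` and `L ∘ χᵢ·`), converge for
   EVERY `g` by the tie (the cut-off families are separated for every `g`: `exists_tendsto_latticeSchwinger_of_tie`), and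
   `T_k(f^θ) = W_k(θ; f)` for `θ` near `θ₀`; in particular `lim_k T_k(f^{θ₀}) = 0` by step 1.
4. `𝓢(ℝ⁴)` is a Fréchet, hence Baire, space (`Literature.Analysis.FunctionSpaces.baireSpace_schwartzMap`), so the
   Banach–Steinhaus theorem for pointwise convergent sequences of continuous multilinear forms
   (`Literature.Analysis.FunctionSpaces.MultilinearMap.tendsto_apply_of_pointwise_tendsto`, Bourbaki EVT III §5) gives
   `T_{k_m}(f^{θ_m}) → lim_k T_k(f^{θ₀}) = 0`, the orbit `θ ↦ f^θ` being continuous into `𝓢(ℝ⁴)ⁿ`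
   (`SchwartzMap.continuous_compCLMOfContinuousLinearEquiv_apply`).  For large `m`, `T_{k_m}(f^{θ_m}) = W_{k_m}(θ_m; f)`,
   contradicting `|W_{k_m}(θ_m; f)| ≥ ε`.  (`n = 0`: the Ward functional is an empty sum.)

References: folklore (N. Bourbaki, *Espaces vectoriels topologiques* III §5, Banach–Steinhaus for multilinear maps;
W. Rudin, *Functional Analysis*, 2nd ed., Thm 2.17).
-/

noncomputable section

namespace Summit.QuantumFields.YangMills.Cruxes.CurvatureAmnesia.WardDefect

open scoped SchwartzMap BigOperators Topology
open MeasureTheory Filter Literature.MathematicalPhysics.QuantumLattice Literature.MathematicalPhysics.AQFT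
  Literature.MathematicalPhysics.QuantumFieldTheory

/-! ### The registered stub -/

/-- (U) uniformity in the rotation angle from pointwise Ward nullity — expanded form of the skeleton's statement;
see the file header for the proof. -/
theorem stub_uniformOfPointwise :
    ∀ (G : Type) [Group G] [TopologicalSpace G] [IsTopologicalGroup G] [CompactSpace G] [MeasurableSpace G]
      [BorelSpace G] (r : LatticeRep G) (sch : SpeciesScheme (YMSpecies G))
      (S : LabelledSchwingerFamily (YMSpecies G) (EuclideanSpace ℝ (Fin 4))),
      (∀ (n : ℕ), n ≠ 0 → ∀ (σ : Fin n → YMSpecies G) (f : Fin n → 𝓢(EuclideanSpace ℝ (Fin 4), ℝ))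
        (F : 𝓢((Fin n → EuclideanSpace ℝ (Fin 4)), ℂ)),
        IsTensorOf F (fun i => ofRealTest (f i)) → IsOffDiagonal F →
          Tendsto (fun k : ℕ => ((latticeSchwinger r.ρ sch (fun s => s.F) k n σ f : ℝ) : ℂ)) atTop
            (𝓝 (S n σ F))) →
      (∀ (n : ℕ) (f : Fin n → 𝓢(EuclideanSpace ℝ (Fin 4), ℝ)),
        ((∀ i, HasCompactSupport (f i : EuclideanSpace ℝ (Fin 4) → ℝ)) ∧
          ∀ i j, i ≠ j → Disjoint (tsupport (f i : EuclideanSpace ℝ (Fin 4) → ℝ))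
            (tsupport (f j : EuclideanSpace ℝ (Fin 4) → ℝ))) →
        Tendsto
          (fun k : ℕ => ∑ i : Fin n,
            latticeSchwinger r.ρ sch (fun s => s.F) k n (fun _ => r.curvature)
              (Function.update f i
                (SchwartzMap.smulLeftCLM ℝ (fun x : EuclideanSpace ℝ (Fin 4) => x 1)
                    (LineDeriv.lineDerivOp (EuclideanSpace.single (0 : Fin 4) (1 : ℝ) : EuclideanSpace ℝ (Fin 4))
                      (f i)) -
                  SchwartzMap.smulLeftCLM ℝ (fun x : EuclideanSpace ℝ (Fin 4) => x 0)
                    (LineDeriv.lineDerivOp (EuclideanSpace.single (1 : Fin 4) (1 : ℝ) : EuclideanSpace ℝ (Fin 4))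
                      (f i)))))
          atTop (𝓝 0)) →
      ∀ (n : ℕ) (f : Fin n → 𝓢(EuclideanSpace ℝ (Fin 4), ℝ)),
        ((∀ i, HasCompactSupport (f i : EuclideanSpace ℝ (Fin 4) → ℝ)) ∧
          ∀ i j, i ≠ j → Disjoint (tsupport (f i : EuclideanSpace ℝ (Fin 4) → ℝ))
            (tsupport (f j : EuclideanSpace ℝ (Fin 4) → ℝ))) →
        ∀ Θ : ℝ, TendstoUniformlyOn
          (fun (k : ℕ) (θ : ℝ) => ∑ i : Fin n,
            latticeSchwinger r.ρ sch (fun s => s.F) k n (fun _ => r.curvature)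
              (Function.update (fun j => linActTest (planeRot (0 : Fin 3) θ) (f j)) i
                (linActTest (planeRot (0 : Fin 3) θ)
                  (SchwartzMap.smulLeftCLM ℝ (fun x : EuclideanSpace ℝ (Fin 4) => x 1)
                      (LineDeriv.lineDerivOp (EuclideanSpace.single (0 : Fin 4) (1 : ℝ) : EuclideanSpace ℝ (Fin 4))
                        (f i)) -
                    SchwartzMap.smulLeftCLM ℝ (fun x : EuclideanSpace ℝ (Fin 4) => x 0)
                      (LineDeriv.lineDerivOp (EuclideanSpace.single (1 : Fin 4) (1 : ℝ) : EuclideanSpace ℝ (Fin 4))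
                        (f i))))))
          (fun _ => 0) atTop (Set.Icc (-Θ) Θ) := by
  intro G _ _ _ _ _ _ r sch S hTie hPt n f hf Θ
  -- the generator `L` as a continuous linear operator and the Ward functional `W`
  set Lop : 𝓢(EuclideanSpace ℝ (Fin 4), ℝ) →L[ℝ] 𝓢(EuclideanSpace ℝ (Fin 4), ℝ) :=
    (SchwartzMap.smulLeftCLM ℝ (fun x : EuclideanSpace ℝ (Fin 4) => x 1)).comp
        (LineDeriv.lineDerivOpCLM ℝ 𝓢(EuclideanSpace ℝ (Fin 4), ℝ)
          (EuclideanSpace.single (0 : Fin 4) (1 : ℝ) : EuclideanSpace ℝ (Fin 4))) -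
      (SchwartzMap.smulLeftCLM ℝ (fun x : EuclideanSpace ℝ (Fin 4) => x 0)).comp
        (LineDeriv.lineDerivOpCLM ℝ 𝓢(EuclideanSpace ℝ (Fin 4), ℝ)
          (EuclideanSpace.single (1 : Fin 4) (1 : ℝ) : EuclideanSpace ℝ (Fin 4))) with hLop
  have hLop_apply : ∀ g, Lop g =
      SchwartzMap.smulLeftCLM ℝ (fun x : EuclideanSpace ℝ (Fin 4) => x 1)
          (LineDeriv.lineDerivOp (EuclideanSpace.single (0 : Fin 4) (1 : ℝ) : EuclideanSpace ℝ (Fin 4)) g) -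
        SchwartzMap.smulLeftCLM ℝ (fun x : EuclideanSpace ℝ (Fin 4) => x 0)
          (LineDeriv.lineDerivOp (EuclideanSpace.single (1 : Fin 4) (1 : ℝ) : EuclideanSpace ℝ (Fin 4)) g) :=
    fun g => rfl
  set W : ℕ → ℝ → ℝ := fun (k : ℕ) (θ : ℝ) => ∑ i : Fin n,
    latticeSchwinger r.ρ sch (fun s => s.F) k n (fun _ => r.curvature)
      (Function.update (fun j => linActTest (planeRot (0 : Fin 3) θ) (f j)) i
        (linActTest (planeRot (0 : Fin 3) θ)
          (SchwartzMap.smulLeftCLM ℝ (fun x : EuclideanSpace ℝ (Fin 4) => x 1)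
              (LineDeriv.lineDerivOp (EuclideanSpace.single (0 : Fin 4) (1 : ℝ) : EuclideanSpace ℝ (Fin 4))
                (f i)) -
            SchwartzMap.smulLeftCLM ℝ (fun x : EuclideanSpace ℝ (Fin 4) => x 0)
              (LineDeriv.lineDerivOp (EuclideanSpace.single (1 : Fin 4) (1 : ℝ) : EuclideanSpace ℝ (Fin 4))
                (f i))))) with hW
  -- the rotation orbit `γ θ = f^θ` of the family
  set γ : ℝ → Fin n → 𝓢(EuclideanSpace ℝ (Fin 4), ℝ) := fun θ j => linActTest (planeRot (d := 3) 0 θ) (f j)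
    with hγ
  have hγc : Continuous γ := by
    refine continuous_pi fun j => ?_
    -- (`linActTest` is `compCLMOfContinuousLinearEquiv`; compare pointwise to stay on one instance path)
    refine (SchwartzMap.continuous_compCLMOfContinuousLinearEquiv_apply ℝ _
      continuous_rho_symm_toContinuousLinearMap (f j)).congr fun t => ?_
    ext x
    rfl
  -- `W k θ = Σᵢ LS_k (update f^θ i (L (fᵢ^θ)))`: `L` commutes with the rotations
  have hWL : ∀ k θ, W k θ = ∑ i : Fin n, latticeSchwinger r.ρ sch (fun s => s.F) k n (fun _ => r.curvature)
      (Function.update (γ θ) i (Lop (γ θ i))) := fun k θ => by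
    simp only [hW, hγ, hLop_apply, linActTest_rotGen_comm]
  -- the rotated families are separated, so `W k θ → 0` pointwise (hypothesis at `f^θ`)
  have hγsep : ∀ θ, (∀ i, HasCompactSupport (γ θ i : EuclideanSpace ℝ (Fin 4) → ℝ)) ∧
      ∀ i j, i ≠ j → Disjoint (tsupport (γ θ i : EuclideanSpace ℝ (Fin 4) → ℝ))
        (tsupport (γ θ j : EuclideanSpace ℝ (Fin 4) → ℝ)) := fun θ => by
    refine ⟨fun i => ?_, fun i j hij => ?_⟩
    · show IsCompact (tsupport _)
      rw [hγ, tsupport_linActTest]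
      exact (hf.1 i).image (planeRot (d := 3) 0 θ).continuous
    · simp only [hγ]
      rw [tsupport_linActTest, tsupport_linActTest]
      exact (Set.disjoint_image_iff (planeRot (d := 3) 0 θ).injective).2 (hf.2 i j hij)
  have hWpt : ∀ θ, Tendsto (fun k => W k θ) atTop (𝓝 0) := fun θ => by
    simp only [hWL]
    exact hPt n (γ θ) (hγsep θ)
  -- suppose the convergence is not uniform on `[-Θ, Θ]`
  rw [Metric.tendstoUniformlyOn_iff]
  by_contra H
  push Not at H
  obtain ⟨ε, hε, hfreq⟩ := H
  obtain ⟨φ, hφ, hφP⟩ := extraction_of_frequently_atTop hfreq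
  have hθ : ∀ m, ∃ θ ∈ Set.Icc (-Θ) Θ, ε ≤ |W (φ m) θ| := fun m => by
    obtain ⟨θ, hθ, h⟩ := hφP m
    refine ⟨θ, hθ, ?_⟩
    rwa [Real.dist_eq, zero_sub, abs_neg] at h
  choose θ hθI hθε using hθ
  obtain ⟨θ₀, -, ψ, hψ, hlim⟩ := isCompact_Icc.tendsto_subseq hθI
  -- `n = 0`: the Ward functional vanishes identically
  rcases Nat.eq_zero_or_pos n with rfl | hn
  · have h0 : W (φ 0) (θ 0) = 0 := by simp [hW]
    have := hθε 0
    rw [h0, abs_zero] at this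
    exact absurd this (not_le.2 hε)
  -- local frame at `θ₀` and the cut-off multilinear family
  obtain ⟨χ, htemp, hχc, hχd, hχev⟩ := stub_uniformOfPointwise_cutoffFrame f hf θ₀
  choose T hTc hT using fun k => exists_multilinearMap_latticeSchwinger r sch k (fun _ : Fin n => r.curvature)
  set P : Fin n → Fin n → (𝓢(EuclideanSpace ℝ (Fin 4), ℝ) →L[ℝ] 𝓢(EuclideanSpace ℝ (Fin 4), ℝ)) := fun i =>
    Function.update (fun j => SchwartzMap.smulLeftCLM ℝ (χ j)) i (Lop.comp (SchwartzMap.smulLeftCLM ℝ (χ i)))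
    with hP
  have hP_apply : ∀ i (g : Fin n → 𝓢(EuclideanSpace ℝ (Fin 4), ℝ)), (fun j => P i j (g j)) =
      Function.update (fun j => SchwartzMap.smulLeftCLM ℝ (χ j) (g j)) i
        (Lop (SchwartzMap.smulLeftCLM ℝ (χ i) (g i))) := fun i g => by
    funext j
    by_cases hji : j = i
    · subst hji
      simp only [hP, Function.update_self, ContinuousLinearMap.comp_apply]
    · simp only [hP, Function.update_of_ne hji]
  set Tk : ℕ → MultilinearMap ℝ (fun _ : Fin n => 𝓢(EuclideanSpace ℝ (Fin 4), ℝ)) ℝ := fun k =>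
    ∑ i : Fin n, (T k).compLinearMap fun j =>
      ((P i j : 𝓢(EuclideanSpace ℝ (Fin 4), ℝ) →L[ℝ] 𝓢(EuclideanSpace ℝ (Fin 4), ℝ)) :
        𝓢(EuclideanSpace ℝ (Fin 4), ℝ) →ₗ[ℝ] 𝓢(EuclideanSpace ℝ (Fin 4), ℝ)) with hTk
  have hTk_apply : ∀ k g, Tk k g = ∑ i : Fin n, latticeSchwinger r.ρ sch (fun s => s.F) k n (fun _ => r.curvature)
      (Function.update (fun j => SchwartzMap.smulLeftCLM ℝ (χ j) (g j)) i
        (Lop (SchwartzMap.smulLeftCLM ℝ (χ i) (g i)))) := fun k g => by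
    simp only [hTk, sum_apply, MultilinearMap.compLinearMap_apply, ContinuousLinearMap.coe_coe,
      hT, hP_apply]
  have hTk_cont : ∀ k, Continuous (Tk k) := fun k => by
    have h : (Tk k : (Fin n → 𝓢(EuclideanSpace ℝ (Fin 4), ℝ)) → ℝ) = fun g => ∑ i : Fin n,
        T k (fun j => P i j (g j)) := by
      funext g
      simp only [hTk, sum_apply, MultilinearMap.compLinearMap_apply, ContinuousLinearMap.coe_coe]
    rw [h]
    exact continuous_finsetSum _ fun i _ =>
      (hTc k).comp (continuous_pi fun j => (P i j).continuous.comp (continuous_apply j))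
  -- the cut-off families are separated for EVERY `g`, so the tie makes `Tk k g` converge
  have hsep : ∀ (g : Fin n → 𝓢(EuclideanSpace ℝ (Fin 4), ℝ)) (i a b : Fin n), a ≠ b →
      Disjoint
        (tsupport ((Function.update (fun j => SchwartzMap.smulLeftCLM ℝ (χ j) (g j)) i
          (Lop (SchwartzMap.smulLeftCLM ℝ (χ i) (g i))) a : 𝓢(EuclideanSpace ℝ (Fin 4), ℝ)) :
            EuclideanSpace ℝ (Fin 4) → ℝ))
        (tsupport ((Function.update (fun j => SchwartzMap.smulLeftCLM ℝ (χ j) (g j)) i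
          (Lop (SchwartzMap.smulLeftCLM ℝ (χ i) (g i))) b : 𝓢(EuclideanSpace ℝ (Fin 4), ℝ)) :
            EuclideanSpace ℝ (Fin 4) → ℝ)) := by
    intro g i a b hab
    have hsub : ∀ c, tsupport ((Function.update (fun j => SchwartzMap.smulLeftCLM ℝ (χ j) (g j)) i
        (Lop (SchwartzMap.smulLeftCLM ℝ (χ i) (g i))) c : 𝓢(EuclideanSpace ℝ (Fin 4), ℝ)) :
          EuclideanSpace ℝ (Fin 4) → ℝ) ⊆ tsupport (χ c) := fun c => by
      by_cases hci : c = i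
      · subst hci
        rw [Function.update_self, hLop_apply]
        exact (tsupport_rotGen_subset _).trans (SchwartzMap.tsupport_smulLeftCLM_subset _ _ |>.trans
          Set.inter_subset_right)
      · rw [Function.update_of_ne hci]
        exact (SchwartzMap.tsupport_smulLeftCLM_subset _ _).trans Set.inter_subset_right
    exact (hχd a b hab).mono (hsub a) (hsub b)
  have hconv : ∀ g, ∃ c : ℝ, Tendsto (fun k => Tk k g) atTop (𝓝 c) := fun g => by
    choose c hc using fun i => exists_tendsto_latticeSchwinger_of_tie r sch S hTie hn.ne' (fun _ => r.curvature)
      (hsep g i)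
    refine ⟨∑ i, c i, ?_⟩
    simp only [hTk_apply]
    exact tendsto_finsetSum _ fun i _ => hc i
  -- on the frame, `Tk k (f^θ) = W k θ`
  have hframe : ∀ ϑ, (∀ j, SchwartzMap.smulLeftCLM ℝ (χ j) (linActTest (planeRot (d := 3) 0 ϑ) (f j)) =
      linActTest (planeRot (d := 3) 0 ϑ) (f j)) → ∀ k, Tk k (γ ϑ) = W k ϑ := fun ϑ hϑ k => by
    rw [hTk_apply, hWL]
    have h1 : (fun j => SchwartzMap.smulLeftCLM ℝ (χ j) (γ ϑ j)) = γ ϑ := funext fun j => hϑ j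
    refine Finset.sum_congr rfl fun i _ => ?_
    rw [h1]
    simp only [hγ, hϑ i]
  -- the limit functional vanishes at `f^{θ₀}`
  set Tlim : (Fin n → 𝓢(EuclideanSpace ℝ (Fin 4), ℝ)) → ℝ := fun g => limUnder atTop fun k => Tk k g with hTlim
  have hTlim : ∀ g, Tendsto (fun k => Tk k g) atTop (𝓝 (Tlim g)) := fun g => tendsto_nhds_limUnder (hconv g)
  have hT0 : Tlim (γ θ₀) = 0 := by
    have h : Tendsto (fun k => Tk k (γ θ₀)) atTop (𝓝 0) := by
      simp only [hframe θ₀ hχev.self_of_nhds]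
      exact hWpt θ₀
    exact tendsto_nhds_unique (hTlim _) h
  -- Banach–Steinhaus: `Tk (φ (ψ m)) (f^{θ (ψ m)}) → Tlim (f^{θ₀}) = 0`
  haveI : BaireSpace 𝓢(EuclideanSpace ℝ (Fin 4), ℝ) := Literature.Analysis.FunctionSpaces.baireSpace_schwartzMap
  have key := Literature.Analysis.FunctionSpaces.MultilinearMap.tendsto_apply_of_pointwise_tendsto ℝ
    (E := fun _ : Fin n => 𝓢(EuclideanSpace ℝ (Fin 4), ℝ)) (κ := fun _ : Fin n => ℕ × ℕ)
    (fun _ => schwartzSeminormFamily ℝ (EuclideanSpace ℝ (Fin 4)) ℝ)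
    (fun _ => schwartz_withSeminorms ℝ (EuclideanSpace ℝ (Fin 4)) ℝ)
    (fun m => Tk (φ (ψ m))) (fun m => hTk_cont _) Tlim
    (fun g => (hTlim g).comp (hφ.comp hψ).tendsto_atTop)
    (x := fun m => γ (θ (ψ m))) (x₀ := γ θ₀) ((hγc.tendsto θ₀).comp hlim)
  rw [hT0] at key
  -- eventually the angles are in the frame, where `Tk = W` is `≥ ε` in absolute value: contradiction
  have hev1 : ∀ᶠ m in atTop, ∀ j, SchwartzMap.smulLeftCLM ℝ (χ j)
      (linActTest (planeRot (d := 3) 0 (θ (ψ m))) (f j)) = linActTest (planeRot (d := 3) 0 (θ (ψ m))) (f j) :=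
    hlim.eventually hχev
  have hev2 : ∀ᶠ m in atTop, dist (Tk (φ (ψ m)) (γ (θ (ψ m)))) 0 < ε := Metric.tendsto_nhds.1 key ε hε
  obtain ⟨m, hm1, hm2⟩ := (hev1.and hev2).exists
  rw [hframe _ hm1, Real.dist_eq, sub_zero] at hm2
  exact absurd (hθε (ψ m)) (not_le.2 hm2)

end Summit.QuantumFields.YangMills.Cruxes.CurvatureAmnesia.WardDefect

end
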